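import Summits.CriticalPhenomena.PercolationContinuityZ3.Theorems.SoloInformedLinkedEvents
import Literature.Probability.Percolation.InequalitiesProofs
import Literature.Probability.Percolation.HalfSpaceBrickSymmetry
import HarnessLib

/-!
# The slab-box face: `θ(p_c) = 0` from an RSW-type bound on ONE box shape (solo seat
`solo-CriticalPhenomena-informed`, paper §7b.3 (d5), the surface side of row (Y))

Row (Y) (`percolationContinuity_of_boxCrossing_le`, `SoloInformedAnnulusEntrance`) derives
`θ(p_c) = 0` on `ℤ^d` from an upper bound `< 1` on the annulus-crossing probabilities
`P_{p_c}(Λ(n) ↔ ∂ⁱⁿΛ(N) in Λ(N))` along a sequence of scales.  This file localises the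
hypothesis to a single box shape, the form in which planar RSW theory is usually quoted.  For
`n ≥ 1`, a coordinate `i` and a sign `ε = ±1` let
`S_{i,ε}(n) = {x ∈ Λ(3n) : ε x_i ≥ n}` be one of the `2d` **slab-boxes** of the annulus
`Λ(3n) ∖ Λ(n-1)` — a box of thickness `2n` in direction `i` and cross-section `(6n)^{d-1}` —
and let `thinCrossing n i ε` be the event that `S_{i,ε}(n)` is crossed by an open path IN ITS
THIN DIRECTION, i.e. from its far face `{ε x_i = 3n}` to its near face `{ε x_i = n}` inside
`S_{i,ε}(n)`.

* `boxCrossing_subset_iUnion_thinCrossing` — the composition lemma: an open path from `Λ(n)` to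
  `∂ⁱⁿΛ(3n)` inside `Λ(3n)` crosses one of the `2d` slab-boxes in its thin direction (follow the
  path backwards from its endpoint `b`, `ε b_i = 3n`, to its first visit to `{ε x_i ≤ n}`).
* `real_boxCrossing_three_mul_le` — hence, by Harris–FKG for the `2d` decreasing events
  "`S_{i,ε}(n)` is not crossed" (`prob_biInter_ge_prod_of_isLowerSet` of the Literature), if each of them has
  probability `≥ c` then `P_p(Λ(n) ↔ ∂ⁱⁿΛ(3n) in Λ(3n)) ≤ 1 - c^{2d}`; all `2d` slab-boxes are
  images of one another under signed coordinate permutations, so their crossing probabilities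
  agree (`real_thinCrossing_eq`).
* `percolationContinuity_of_thinCrossing_le`, `percolationContinuityZ3_of_thinCrossing_le` —
  **the slab-box face**: if for some `c > 0` and infinitely many `n`
  `P_{p_c}(thinCrossing n i₀ 1) ≤ 1 - c` (ONE slab-box, ONE aspect ratio `1 : 3`), then
  `θ(p_c) = 0`; at `d = 3`: if the box `[n,3n] × [-3n,3n]²` is crossed in its thin direction at
  `p_c(ℤ³)` with probability at most `1 - c` infinitely often, then `PercolationContinuityZ3`.

Reading (paper §7b.3 (d5)).  "No open thin-direction crossing of `[n,3n]×[-3n,3n]²`" is, by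
duality, the existence of a closed plaquette surface separating the two large faces of the
slab-box — dual surfaces crossing the box THE HARD WAY.  In the plane the analogous statement
(closed dual paths crossing `2n × 6n` rectangles the long way with probability `≥ c`) is the
Russo–Seymour–Welsh theorem; so the slab-box face is the precise sense in which the conjunct
`θ(p_c(ℤ³)) = 0` follows from "an RSW lower bound for separating surfaces at `p_c(ℤ³)`".  No such
bound is known; the path-side mirror statement (a LOWER bound `85^{-d}` on the annulus-crossing
probabilities) is unconditional (`SoloInformedCrossingLowerBound`), and above six dimensions the
hypothesis of the slab-box face fails although its conclusion holds.  Elementary; the Harris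
step is Grimmett (1999) Thm 2.4. [folklore]
-/

noncomputable section

namespace Summit.CriticalPhenomena.PercolationContinuityZ3.Theorems

open MeasureTheory ProbabilityTheory Filter Topology
open Literature.Probability.Percolation Literature.Probability.LatticeModels
open Literature.Probability.Percolation.CerfDembinVanishing
open scoped ENNReal

namespace SurfaceTension

variable {d : ℕ}

/-! ## Slab-boxes and their thin-direction crossings -/

/-- The slab-box `S_{i,ε}(n) = {x ∈ Λ(3n) : n ≤ ε x_i}`. -/
def slabBox (n : ℕ) (i : Fin d) (ε : ℤˣ) : Set (Site d) :=
  {x | x ∈ box d (3 * n) ∧ (n : ℤ) ≤ (ε : ℤ) * x i}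

/-- The near face `{ε x_i = n}` of the slab-box. -/
def nearFace (n : ℕ) (i : Fin d) (ε : ℤˣ) : Set (Site d) :=
  {x | x ∈ slabBox n i ε ∧ (ε : ℤ) * x i = n}

/-- The far face `{ε x_i = 3n}` of the slab-box. -/
def farFace (n : ℕ) (i : Fin d) (ε : ℤˣ) : Set (Site d) :=
  {x | x ∈ slabBox n i ε ∧ (ε : ℤ) * x i = 3 * n}

/-- The thin-direction open crossing of the slab-box: its far face is joined to its near face by
an open path inside it. -/
def thinCrossing (n : ℕ) (i : Fin d) (ε : ℤˣ) : Set (BondConfig (Site d)) :=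
  linked (slabBox n i ε) (farFace n i ε) (nearFace n i ε)

/-- Linking events are increasing. -/
theorem isUpperSet_linked (S A B : Set (Site d)) : IsUpperSet (linked S A B) :=
  isUpperSet_iUnion₂ fun a _ => isUpperSet_iUnion₂ fun b _ => isUpperSet_inConn S a b

/-- `thinCrossing` is increasing. -/
theorem isUpperSet_thinCrossing (n : ℕ) (i : Fin d) (ε : ℤˣ) :
    IsUpperSet (thinCrossing n i ε) :=
  isUpperSet_linked _ _ _

/-- `thinCrossing` is measurable. -/
theorem measurableSet_thinCrossing (n : ℕ) (i : Fin d) (ε : ℤˣ) :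
    MeasurableSet (thinCrossing n i ε) :=
  measurableSet_linked _ _ _

/-- A sign times an integer is at most its absolute value. -/
theorem units_mul_le_abs (ε : ℤˣ) (z : ℤ) : (ε : ℤ) * z ≤ |z| := by
  rcases Int.units_eq_one_or ε with h | h
  · simp [h, le_abs_self]
  · simp [h, neg_le_abs]

/-- Nearest neighbours of `ℤ^d` differ by at most one in each coordinate. -/
theorem coord_sub_le_one_of_adj {x y : Site d} (h : (zdGraph d).Adj x y) (i : Fin d) :
    x i - y i ≤ 1 ∧ y i - x i ≤ 1 := by
  have key : ∀ j : Fin d, (Pi.single j (1 : ℤ) : Site d) i ≤ 1 ∧ 0 ≤ (Pi.single j (1 : ℤ) : Site d) i := by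
    intro j
    by_cases hij : i = j
    · subst hij; simp
    · simp [Pi.single_eq_of_ne hij]
  obtain ⟨j, hj | hj⟩ := (zdGraph_adj_iff x y).1 h
  · rw [hj]; simp only [Pi.add_apply]; constructor <;> linarith [(key j).1, (key j).2]
  · rw [hj]; simp only [Pi.add_apply]; constructor <;> linarith [(key j).1, (key j).2]

/-- Signed coordinates of nearest neighbours differ by at most one. -/
theorem units_mul_sub_le_one_of_adj (ε : ℤˣ) {x y : Site d} (h : (zdGraph d).Adj x y) (i : Fin d) :
    (ε : ℤ) * x i - (ε : ℤ) * y i ≤ 1 := by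
  have h1 := coord_sub_le_one_of_adj h i
  rcases Int.units_eq_one_or ε with hε | hε
  · simp [hε]; linarith [h1.1]
  · simp [hε]; linarith [h1.2]

/-! ## The composition lemma -/

/-- **Composition lemma.** An open path from `Λ(n)` to `∂ⁱⁿΛ(3n)` inside `Λ(3n)` (`n ≥ 1`) crosses
one of the `2d` slab-boxes in its thin direction. -/
theorem boxCrossing_subset_iUnion_thinCrossing {n : ℕ} (hn : 1 ≤ n) :
    boxCrossing d n (3 * n) ⊆ ⋃ i : Fin d, ⋃ ε : ℤˣ, thinCrossing n i ε := by
  intro ω hω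
  rw [boxCrossing_eq_linked, mem_linked_iff] at hω
  obtain ⟨b, hb, a, ha, hab⟩ := hω
  rw [Finset.mem_coe] at ha hb
  have hbB : b ∈ box d (3 * n) := (mem_innerBoundary_iff.1 hb).1
  obtain ⟨i, hi⟩ := exists_eq_of_mem_innerBoundary_box hb
  push_cast at hi
  -- the sign of the exit coordinate
  obtain ⟨ε, hε⟩ : ∃ ε : ℤˣ, (ε : ℤ) * b i = 3 * n := by
    rcases hi with hi | hi
    · exact ⟨1, by rw [hi]; simp⟩
    · exact ⟨-1, by rw [hi]; simp⟩
  -- the open path, inside `Λ(3n)`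
  rw [mem_inConn_iff] at hab
  obtain ⟨W⟩ := hab
  -- follow it from `b` to its first visit to `{ε x_i ≤ n}`
  set R : Set (Site d) := {x | (n : ℤ) < (ε : ℤ) * x i} with hR
  have hbR : b ∈ R := by
    simp only [hR, Set.mem_setOf_eq, hε]; omega
  have haR : a ∉ R := by
    simp only [hR, Set.mem_setOf_eq, not_lt]
    have h1 := (mem_box.1 ha) i
    have h2 := units_mul_le_abs ε (a i)
    have h3 : |a i| ≤ n := abs_le.2 ⟨h1.1, h1.2⟩
    linarith
  obtain ⟨b', c', hb'R, hc'R, hadj, hreach⟩ :=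
    exists_exit_of_walk (G := zdGraph d)
      (H := openGraph ω ⊓ withinGraph (zdGraph d) ↑(box d (3 * n)))
      (inf_le_right.trans (withinGraph_le _ _)) R W hbR haR
  have hopen : (openGraph ω).Adj b' c' := ((SimpleGraph.inf_adj _ _ _ _).1 hadj).1
  have hwithin := withinGraph_adj.1 ((SimpleGraph.inf_adj _ _ _ _).1 hadj).2
  -- `hwithin : (zdGraph d).Adj b' c' ∧ b' ∈ Λ(3n) ∧ c' ∈ Λ(3n)`
  simp only [hR, Set.mem_setOf_eq, not_lt] at hb'R hc'R
  have hstep := units_mul_sub_le_one_of_adj ε hwithin.1 i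
  have hc'eq : (ε : ℤ) * c' i = n := by linarith
  -- membership of the endpoints
  have hbS : b ∈ slabBox n i ε := ⟨hbB, by rw [hε]; omega⟩
  have hbF : b ∈ farFace n i ε := ⟨hbS, hε⟩
  have hc'S : c' ∈ slabBox n i ε := ⟨hwithin.2.2, hc'eq.ge⟩
  have hc'N : c' ∈ nearFace n i ε := ⟨hc'S, hc'eq⟩
  have hb'S : b' ∈ slabBox n i ε := ⟨hwithin.2.1, hb'R.le⟩
  -- the path from `b` to `b'` and the edge `b' c'` lie in the slab-box
  have hle : (openGraph ω ⊓ withinGraph (zdGraph d) ↑(box d (3 * n))) ⊓ withinGraph (zdGraph d) R ≤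
      openGraph ω ⊓ withinGraph (zdGraph d) (slabBox n i ε) := by
    intro u v huv
    rw [SimpleGraph.inf_adj, SimpleGraph.inf_adj, withinGraph_adj, withinGraph_adj] at huv
    rw [SimpleGraph.inf_adj, withinGraph_adj]
    obtain ⟨⟨ho, hG, hu, hv⟩, -, huR, hvR⟩ := huv
    exact ⟨ho, hG, ⟨hu, le_of_lt huR⟩, ⟨hv, le_of_lt hvR⟩⟩
  have hK : (openGraph ω ⊓ withinGraph (zdGraph d) (slabBox n i ε)).Adj b' c' :=
    (SimpleGraph.inf_adj _ _ _ _).2 ⟨hopen, withinGraph_adj.2 ⟨hwithin.1, hb'S, hc'S⟩⟩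
  have hreach' : (openGraph ω ⊓ withinGraph (zdGraph d) (slabBox n i ε)).Reachable b c' :=
    (hreach.mono hle).trans hK.reachable
  exact Set.mem_iUnion.2 ⟨i, Set.mem_iUnion.2 ⟨ε, mem_linked_iff.2 ⟨b, hbF, c', hc'N,
    mem_inConn_iff.2 hreach'⟩⟩⟩

/-! ## Harris–FKG for the `2d` blocking events -/

/-- **Blocking all `2d` slab-boxes blocks the annulus.** If each slab-box `S_{i,ε}(n)` fails to be
crossed in its thin direction with probability at least `c ≥ 0`, then
`P_p(Λ(n) ↔ ∂ⁱⁿΛ(3n) in Λ(3n)) ≤ 1 - c^{2d}` (`n ≥ 1`). -/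
theorem real_boxCrossing_three_mul_le (p : unitInterval) {n : ℕ} (hn : 1 ≤ n) {c : ℝ} (hc : 0 ≤ c)
    (h : ∀ (i : Fin d) (ε : ℤˣ), c ≤ 1 - (bondPercolation (zdGraph d) p).real (thinCrossing n i ε)) :
    (bondPercolation (zdGraph d) p).real (boxCrossing d n (3 * n)) ≤ 1 - c ^ (2 * d) := by
  classical
  set μ := bondPercolation (zdGraph d) p with hμ
  let A : Fin d × ℤˣ → Set (BondConfig (Site d)) := fun q => (thinCrossing n q.1 q.2)ᶜ
  have hAm : ∀ q ∈ (Finset.univ : Finset (Fin d × ℤˣ)), MeasurableSet (A q) :=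
    fun q _ => (measurableSet_thinCrossing n q.1 q.2).compl
  have hAl : ∀ q ∈ (Finset.univ : Finset (Fin d × ℤˣ)), IsLowerSet (A q) :=
    fun q _ => (isUpperSet_thinCrossing n q.1 q.2).compl
  -- each blocking event has probability `≥ c`
  have hAc : ∀ q ∈ (Finset.univ : Finset (Fin d × ℤˣ)), c ≤ μ.real (A q) := by
    intro q _
    change c ≤ μ.real (thinCrossing n q.1 q.2)ᶜ
    rw [probReal_compl_eq_one_sub (measurableSet_thinCrossing n q.1 q.2)]
    exact h q.1 q.2
  -- Harris: the intersection has probability `≥ c ^ (2d)`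
  have hprod : c ^ (2 * d) ≤ μ.real (⋂ q ∈ (Finset.univ : Finset (Fin d × ℤˣ)), A q) := by
    calc c ^ (2 * d) = ∏ _q ∈ (Finset.univ : Finset (Fin d × ℤˣ)), c := by
          rw [Finset.prod_const, Finset.card_univ, Fintype.card_prod, Fintype.card_fin,
            Fintype.card_units_int, mul_comm]
      _ ≤ ∏ q ∈ (Finset.univ : Finset (Fin d × ℤˣ)), μ.real (A q) :=
          Finset.prod_le_prod (fun _ _ => hc) hAc
      _ ≤ μ.real (⋂ q ∈ (Finset.univ : Finset (Fin d × ℤˣ)), A q) :=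
          prob_biInter_ge_prod_of_isLowerSet (zdGraph d) p _ A hAl hAm
  -- the intersection is contained in the complement of the annulus crossing
  have hsub : (⋂ q ∈ (Finset.univ : Finset (Fin d × ℤˣ)), A q) ⊆ (boxCrossing d n (3 * n))ᶜ := by
    intro ω hω hcross
    obtain ⟨i, hi⟩ := Set.mem_iUnion.1 (boxCrossing_subset_iUnion_thinCrossing hn hcross)
    obtain ⟨ε, hε⟩ := Set.mem_iUnion.1 hi
    have := (Set.mem_iInter₂.1 hω) (i, ε) (Finset.mem_univ _)
    exact this hε
  have hcompl : μ.real (boxCrossing d n (3 * n))ᶜ = 1 - μ.real (boxCrossing d n (3 * n)) :=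
    probReal_compl_eq_one_sub (measurableSet_boxCrossing n (3 * n))
  have := (hprod.trans (measureReal_mono hsub)).trans_eq hcompl
  linarith

/-! ## All slab-boxes are alike -/

/-- Images under a bijection, by a pointwise membership criterion. -/
theorem image_eq_of_forall_iff (φ : Site d ≃ Site d) {A B : Set (Site d)}
    (h : ∀ x, x ∈ A ↔ φ x ∈ B) : φ '' A = B := by
  ext y
  constructor
  · rintro ⟨x, hx, rfl⟩
    exact (h x).1 hx
  · intro hy
    exact ⟨φ.symm y, (h _).2 (by rwa [Equiv.apply_symm_apply]), Equiv.apply_symm_apply φ y⟩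

/-- **Symmetry.** All `2d` slab-boxes have the same thin-crossing probability: a signed
coordinate permutation maps `S_{i,ε}(n)` with its faces onto `S_{j,+1}(n)` with its faces. -/
theorem real_thinCrossing_eq (p : unitInterval) (n : ℕ) (i j : Fin d) (ε : ℤˣ) :
    (bondPercolation (zdGraph d) p).real (thinCrossing n i ε) =
      (bondPercolation (zdGraph d) p).real (thinCrossing n j 1) := by
  set φ : zdGraph d ≃g zdGraph d := zdSignedPermIso (Equiv.swap i j) (fun _ => ε) with hφ
  have key : ∀ x : Site d, (φ x) j = (ε : ℤ) * x i := by
    intro x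
    simp [hφ, Equiv.symm_swap, Equiv.swap_apply_right]
  have hbox : ∀ x : Site d, φ x ∈ box d (3 * n) ↔ x ∈ box d (3 * n) := fun x => by
    simpa [hφ] using signedPerm_mem_box_iff (Equiv.swap i j) (fun _ => ε) (n := 3 * n) (x := x)
  have hS : ∀ x : Site d, x ∈ slabBox n i ε ↔ φ x ∈ slabBox n j 1 := fun x => by
    simp only [slabBox, Set.mem_setOf_eq, hbox, key, Units.val_one, one_mul]
  have hSim : (φ.toEquiv : Site d ≃ Site d) '' slabBox n i ε = slabBox n j 1 :=
    image_eq_of_forall_iff φ.toEquiv hS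
  have hFim : (φ.toEquiv : Site d ≃ Site d) '' farFace n i ε = farFace n j 1 :=
    image_eq_of_forall_iff φ.toEquiv fun x => by
      simp only [farFace, Set.mem_setOf_eq, hS, Units.val_one, one_mul]
      exact and_congr_right fun _ => by rw [show ((φ.toEquiv : Site d ≃ Site d) x) j = (φ x) j from rfl, key]
  have hNim : (φ.toEquiv : Site d ≃ Site d) '' nearFace n i ε = nearFace n j 1 :=
    image_eq_of_forall_iff φ.toEquiv fun x => by
      simp only [nearFace, Set.mem_setOf_eq, hS, Units.val_one, one_mul]
      exact and_congr_right fun _ => by rw [show ((φ.toEquiv : Site d ≃ Site d) x) j = (φ x) j from rfl, key]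
  have himg := real_linked_image φ p (slabBox n i ε) (farFace n i ε) (nearFace n i ε)
  rw [thinCrossing, thinCrossing, ← himg]
  change (bondPercolation (zdGraph d) p).real
      (linked ((φ.toEquiv : Site d ≃ Site d) '' slabBox n i ε)
        ((φ.toEquiv : Site d ≃ Site d) '' farFace n i ε)
        ((φ.toEquiv : Site d ≃ Site d) '' nearFace n i ε)) = _
  rw [hSim, hFim, hNim]

/-! ## The slab-box face -/

/-- **The slab-box face, `2d`-box form.** If for some `c > 0` and infinitely many `n` every one of
the `2d` slab-boxes `S_{i,ε}(n)` is crossed in its thin direction at `p_c` with probability at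
most `1 - c`, then `θ(p_c) = 0`. -/
theorem percolationContinuity_of_forall_thinCrossing_le {c : ℝ} (hc : 0 < c)
    (h : ∃ᶠ n in atTop, ∀ (i : Fin d) (ε : ℤˣ),
      (bondPercolation (zdGraph d) (criticalProbI d)).real (thinCrossing n i ε) ≤ 1 - c) :
    PercolationContinuity d := by
  refine percolationContinuity_of_boxCrossing_le (δ := c ^ (2 * d)) (by positivity) fun M => ?_
  obtain ⟨n, hn, hnM⟩ := (h.and_eventually (eventually_ge_atTop (max M 1))).exists
  refine ⟨n, 3 * n, (le_max_left M 1).trans hnM, by omega, ?_⟩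
  exact real_boxCrossing_three_mul_le (criticalProbI d) ((le_max_right M 1).trans hnM) hc.le
    fun i ε => by linarith [hn i ε]

/-- **The slab-box face.** If for ONE coordinate direction `i₀`, some `c > 0` and infinitely many
`n` the slab-box `{x ∈ Λ(3n) : x_{i₀} ≥ n}` (thickness `2n`, cross-section `(6n)^{d-1}`) is crossed
in its thin direction at `p_c` with probability at most `1 - c`, then `θ(p_c) = 0` on `ℤ^d`. -/
theorem percolationContinuity_of_thinCrossing_le (i₀ : Fin d) {c : ℝ} (hc : 0 < c)
    (h : ∃ᶠ n in atTop,
      (bondPercolation (zdGraph d) (criticalProbI d)).real (thinCrossing n i₀ 1) ≤ 1 - c) :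
    PercolationContinuity d :=
  percolationContinuity_of_forall_thinCrossing_le hc
    (h.mono fun n hn i ε => by rwa [real_thinCrossing_eq (criticalProbI d) n i i₀ ε])

/-- **The slab-box face on `ℤ³`.** If the box `[n, 3n] × [-3n, 3n]²` is crossed by an open path
in its thin direction (from `{x₀ = 3n}` to `{x₀ = n}`, inside the box) at `p_c(ℤ³)` with probability
at most `1 - c` for infinitely many `n` (`c > 0` fixed) — equivalently, a closed plaquette surface
separates its two large faces with probability at least `c` — then `θ(p_c) = 0` on `ℤ³`. -/
theorem percolationContinuityZ3_of_thinCrossing_le {c : ℝ} (hc : 0 < c)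
    (h : ∃ᶠ n in atTop,
      (bondPercolation (zdGraph 3) (criticalProbI 3)).real (thinCrossing n (0 : Fin 3) 1) ≤ 1 - c) :
    PercolationContinuityZ3 :=
  percolationContinuity_of_thinCrossing_le 0 hc h

end SurfaceTension

end Summit.CriticalPhenomena.PercolationContinuityZ3.Theorems

end
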